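import Summits.Parity.BatemanHorn.Theses.HurwitzTauber
import Summits.Parity.BatemanHorn.Theorems.IsogenyRedeiLambdaToCount
import Summits.Parity.BatemanHorn.Theorems.PolynomialMobiusPolyMobiusTailSummitEquivalence

/-!
# Strategist r1 census companion for crux `HurwitzTauber.LogMobiusTail` (stmt-Parity-19022)

KERNEL-CHECKED COSTUME CERTIFICATE (no `sorry`).  Write `a_f(n) = ∏ᵢ Λ(fᵢ(n))` and
`D_f(σ) = Σ_n a_f(n) n^{-σ}` (`σ > 1`).  The *Abel / Dirichlet-mean (logarithmic-density) form of
Bateman–Horn* is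

  `AbelBatemanHorn : ∀ BH-systems f, ∃ C > 0, HasBatemanHornConst f C ∧ (σ−1)·D_f(σ) → C (σ → 1⁺)`.

The theorems below certify, for route `route-Parity-HurwitzTauber`:

* `abelBatemanHorn_of_batemanHorn : BatemanHorn → AbelBatemanHorn` (count ⇒ Λ-asymptotic by the tree's
  `lambda_isEquivalent_of_batemanHornAsymptotic`, Cesàro ⇒ Abel by Mathlib's
  `LSeries_tendsto_sub_mul_nhds_one_of_tendsto_sum_div_and_nonneg`);
* `slowDecrease_of_batemanHorn : BatemanHorn → SlowDecrease` (crux r3 is a consequence of the summit);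
* `logMobiusTail_iff_abelBatemanHorn : RootHurwitzLaw → PolarPart → SingularSeriesAbel →
  (LogMobiusTail ↔ AbelBatemanHorn)` — modulo the route's OWN parity-free crux r4 and its two
  theorem-grade supports (exact Hurwitz-frame identity; singular series), the deciding crux r2 IS the
  logarithmic-density conjunct of Bateman–Horn, written in Möbius-tail currency;
* `logMobiusTail_of_batemanHorn` (`S → C` modulo the same items) and
  `batemanHorn_iff_abel_and_slow` / `batemanHorn_iff_tail_and_slow`: modulo the theorem-grade supports
  `LambdaUpperBound`, `KaramataLog`, `SchmidtScales` (+ `RootHurwitzLaw`, `PolarPart`,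
  `SingularSeriesAbel` for the tail form) the summit conjunct is EXACTLY the conjunction of the route's
  two parity-sensitive cruxes: `BatemanHorn ↔ LogMobiusTail ∧ SlowDecrease` — an (unassigned) conjunct
  split of `S` in the sense of the tribunal's T1′ rule.

See `STRATEGY-CENSUS.md` in the same crux directory for the transfer / strengthen / decomposition /
negation census and the literature placement.
-/

namespace Summit.Parity.BatemanHorn.Cruxes.LogMobiusTail.StrategyCensus

open scoped BigOperators Topology Classical
open Filter Asymptotics Finset
open Literature.NumberTheory.Sieve
open Summit.Parity.BatemanHorn.Theses.HurwitzTauber (LogMobiusTail RootHurwitzLaw SlowDecrease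
  FrameToBH SingularSeriesAbel PolarPart LambdaUpperBound KaramataLog SchmidtScales LambdaToCount)
open Summit.Parity.BatemanHorn.Theorems.PolyMobiusTail.SummitEquivalence
  (lambda_isEquivalent_of_batemanHornAsymptotic)

set_option linter.unusedVariables false

/-! ## The Abel-mean (logarithmic-density) form of Bateman–Horn -/

/-- Abel / Dirichlet-mean Bateman–Horn at ONE system `f`: `(σ−1)·Σ_n (∏ᵢ Λ(fᵢ(n))) n^{−σ} → C(f) > 0`
as `σ → 1⁺`, with `C(f)` the Bateman–Horn constant (ordered Euler product). -/
def AbelBHAt {k : ℕ} (f : Fin k → Polynomial ℤ) : Prop :=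
  ∃ C : ℝ, 0 < C ∧ HasBatemanHornConst f C ∧
    (∀ σ : ℝ, 1 < σ → Summable (fun n : ℕ =>
      (∏ i, ArithmeticFunction.vonMangoldt (((f i).eval (n : ℤ)).toNat)) * (n : ℝ) ^ (-σ))) ∧
    Tendsto (fun σ : ℝ => (σ - 1) * ∑' n : ℕ,
      (∏ i, ArithmeticFunction.vonMangoldt (((f i).eval (n : ℤ)).toNat)) * (n : ℝ) ^ (-σ))
      (𝓝[>] 1) (𝓝 C)

/-- Abel / Dirichlet-mean (logarithmic-density) Bateman–Horn for every Bateman–Horn system. -/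
def AbelBatemanHorn : Prop :=
  ∀ (k : ℕ) (f : Fin k → Polynomial ℤ), IsBatemanHornSystem f → AbelBHAt f

/-! ## Analysis lemmas -/

/-- `0 ≤ ∏ᵢ Λ(fᵢ(n))`. -/
theorem lambdaProd_nonneg {k : ℕ} (f : Fin k → Polynomial ℤ) (n : ℕ) :
    0 ≤ ∏ i, ArithmeticFunction.vonMangoldt (((f i).eval (n : ℤ)).toNat) :=
  Finset.prod_nonneg fun i _ => ArithmeticFunction.vonMangoldt_nonneg

/-- **Cesàro mean ⇒ Abel mean (real form).**  For `a ≥ 0` with `x⁻¹ Σ_{n≤x} a(n) → l`, the real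
Dirichlet series `Σ a(n) n^{−σ}` converges for `σ > 1` and `(σ−1) Σ a(n) n^{−σ} → l` as `σ → 1⁺`.
(Mathlib: `LSeries_tendsto_sub_mul_nhds_one_of_tendsto_sum_div_and_nonneg`, transported from the
complex `LSeries` to the real series.) -/
theorem abel_of_cesaro {a : ℕ → ℝ} {l : ℝ} (ha : ∀ n, 0 ≤ a n)
    (hlim : Tendsto (fun n : ℕ => (∑ k ∈ Icc 1 n, a k) / (n : ℝ)) atTop (𝓝 l)) :
    (∀ σ : ℝ, 1 < σ → Summable (fun n : ℕ => a n * (n : ℝ) ^ (-σ))) ∧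
    Tendsto (fun σ : ℝ => (σ - 1) * ∑' n : ℕ, a n * (n : ℝ) ^ (-σ)) (𝓝[>] 1) (𝓝 l) := by
  -- the complex `LSeries` term is the real summand
  have hterm : ∀ σ : ℝ, 1 < σ → ∀ n : ℕ,
      LSeries.term (fun n => (a n : ℂ)) (σ : ℂ) n = ((a n * (n : ℝ) ^ (-σ) : ℝ) : ℂ) := by
    intro σ hσ n
    rcases eq_or_ne n 0 with rfl | hn
    · rw [LSeries.term_zero, Nat.cast_zero, Real.zero_rpow (by linarith : (-σ : ℝ) ≠ 0), mul_zero,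
        Complex.ofReal_zero]
    · rw [LSeries.term_of_ne_zero hn, Real.rpow_neg (Nat.cast_nonneg n), Complex.ofReal_mul,
        Complex.ofReal_inv, Complex.ofReal_cpow (Nat.cast_nonneg n), Complex.ofReal_natCast,
        div_eq_mul_inv]
  have hsum : ∀ σ : ℝ, 1 < σ → Summable (fun n : ℕ => a n * (n : ℝ) ^ (-σ)) := by
    intro σ hσ
    have hS : LSeriesSummable (fun n => (a n : ℂ)) (σ : ℂ) := by
      refine LSeriesSummable_of_sum_norm_bigO_and_nonneg ?_ ha zero_le_one (by simpa using hσ)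
      exact isBigO_atTop_natCast_rpow_of_tendsto_div_rpow (a := l) (by simpa using hlim)
    have h' : Summable (fun n : ℕ => ((a n * (n : ℝ) ^ (-σ) : ℝ) : ℂ)) :=
      hS.congr (hterm σ hσ)
    exact Complex.summable_ofReal.mp h'
  refine ⟨hsum, ?_⟩
  have hC := LSeries_tendsto_sub_mul_nhds_one_of_tendsto_sum_div_and_nonneg a hlim ha
  have hre : Tendsto (fun s : ℝ => (((s : ℂ) - 1) * LSeries (fun n => (a n : ℂ)) (s : ℂ)).re)
      (𝓝[>] 1) (𝓝 ((l : ℂ).re)) :=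
    (Complex.continuous_re.tendsto _).comp hC
  rw [Complex.ofReal_re] at hre
  have key : ∀ s : ℝ, 1 < s →
      (((s : ℂ) - 1) * LSeries (fun n => (a n : ℂ)) (s : ℂ)).re = (s - 1) * ∑' n : ℕ, a n * (n : ℝ) ^ (-s) := by
    intro s hs
    rw [LSeries, tsum_congr (hterm s hs), ← Complex.ofReal_tsum, ← Complex.ofReal_one,
      ← Complex.ofReal_sub, ← Complex.ofReal_mul, Complex.ofReal_re]
  refine hre.congr' ?_
  filter_upwards [self_mem_nhdsWithin] with s hs
  exact key s hs

/-- **Abel-mean limit algebra** (Hurwitz frame ⇒ Abel mean).  If `D(σ) = (−1)^k (T(σ) + P(σ) + R(σ))`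
for `σ > 1`, `(σ−1)T → 0`, `(σ−1)P − S → 0`, `(σ−1)R → 0` and `(−1)^k S → C`, then `(σ−1)D → C`. -/
theorem abel_limit_of_pieces (k : ℕ) (D T P R S : ℝ → ℝ) (C : ℝ)
    (hid : ∀ σ : ℝ, 1 < σ → D σ = (-1 : ℝ) ^ k * (T σ + P σ + R σ))
    (hT : Tendsto (fun σ : ℝ => (σ - 1) * T σ) (𝓝[>] 1) (𝓝 0))
    (hP : Tendsto (fun σ : ℝ => (σ - 1) * P σ - S σ) (𝓝[>] 1) (𝓝 0))
    (hR : Tendsto (fun σ : ℝ => (σ - 1) * R σ) (𝓝[>] 1) (𝓝 0))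
    (hS : Tendsto (fun σ : ℝ => (-1 : ℝ) ^ k * S σ) (𝓝[>] 1) (𝓝 C)) :
    Tendsto (fun σ : ℝ => (σ - 1) * D σ) (𝓝[>] 1) (𝓝 C) := by
  have hlim : Tendsto (fun σ : ℝ => (-1 : ℝ) ^ k * ((σ - 1) * T σ + ((σ - 1) * P σ - S σ) +
      (σ - 1) * R σ) + (-1 : ℝ) ^ k * S σ) (𝓝[>] 1) (𝓝 ((-1 : ℝ) ^ k * (0 + 0 + 0) + C)) :=
    (((hT.add hP).add hR).const_mul ((-1 : ℝ) ^ k)).add hS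
  simp only [add_zero, mul_zero, zero_add] at hlim
  refine hlim.congr' ?_
  filter_upwards [self_mem_nhdsWithin] with σ hσ
  rw [hid σ hσ]
  ring

/-- **Tail limit algebra** (Abel mean ⇒ tail law).  If `D(σ) = (−1)^k (T(σ) + P(σ) + R(σ))` for
`σ > 1`, `(σ−1)D → C`, `(σ−1)P − S → 0`, `(σ−1)R → 0` and `(−1)^k S → C`, then `(σ−1)T → 0`. -/
theorem tail_limit_of_pieces (k : ℕ) (D T P R S : ℝ → ℝ) (C : ℝ)
    (hid : ∀ σ : ℝ, 1 < σ → D σ = (-1 : ℝ) ^ k * (T σ + P σ + R σ))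
    (hD : Tendsto (fun σ : ℝ => (σ - 1) * D σ) (𝓝[>] 1) (𝓝 C))
    (hP : Tendsto (fun σ : ℝ => (σ - 1) * P σ - S σ) (𝓝[>] 1) (𝓝 0))
    (hR : Tendsto (fun σ : ℝ => (σ - 1) * R σ) (𝓝[>] 1) (𝓝 0))
    (hS : Tendsto (fun σ : ℝ => (-1 : ℝ) ^ k * S σ) (𝓝[>] 1) (𝓝 C)) :
    Tendsto (fun σ : ℝ => (σ - 1) * T σ) (𝓝[>] 1) (𝓝 0) := by
  have hlim : Tendsto (fun σ : ℝ => (-1 : ℝ) ^ k * ((σ - 1) * D σ) - ((σ - 1) * P σ - S σ)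
      - (-1 : ℝ) ^ k * ((-1 : ℝ) ^ k * S σ) - (σ - 1) * R σ) (𝓝[>] 1)
      (𝓝 ((-1 : ℝ) ^ k * C - 0 - (-1 : ℝ) ^ k * C - 0)) :=
    (((hD.const_mul _).sub hP).sub (hS.const_mul _)).sub hR
  simp only [sub_zero, sub_self] at hlim
  refine hlim.congr' ?_
  filter_upwards [self_mem_nhdsWithin] with σ hσ
  have hk : ((-1 : ℝ) ^ k) * ((-1 : ℝ) ^ k) = 1 := by
    rw [← mul_pow, neg_one_mul, neg_neg, one_pow]
  rw [hid σ hσ]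
  linear_combination ((σ - 1) * (T σ + P σ + R σ) - S σ) * hk

/-- **Ratio limit ⇒ asymptotic equivalence** (`C ≠ 0`): `u(x)/x → C` gives `u ~ C·x`. -/
theorem isEquivalent_of_tendsto_div (u : ℕ → ℝ) (C : ℝ) (hC : C ≠ 0)
    (h : Tendsto (fun x : ℕ => u x / (x : ℝ)) atTop (𝓝 C)) :
    IsEquivalent atTop u (fun x : ℕ => C * (x : ℝ)) := by
  refine isEquivalent_of_tendsto_one ?_
  have h1 : Tendsto (fun x : ℕ => u x / (x : ℝ) / C) atTop (𝓝 (C / C)) := h.div_const C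
  rw [div_self hC] at h1
  refine h1.congr' (Eventually.of_forall fun x => ?_)
  show u x / (x : ℝ) / C = u x / (C * (x : ℝ))
  rw [div_div, mul_comm (x : ℝ) C]

/-- **Asymptotic equivalence ⇒ ratio limit**: `u ~ C·x` gives `u(x)/x → C`. -/
theorem tendsto_div_of_isEquivalent (u : ℕ → ℝ) (C : ℝ)
    (h : IsEquivalent atTop u (fun x : ℕ => C * (x : ℝ))) :
    Tendsto (fun x : ℕ => u x / (x : ℝ)) atTop (𝓝 C) := by
  have h1 : Tendsto (fun x : ℕ => C * (x : ℝ) / (x : ℝ)) atTop (𝓝 C) := by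
    refine tendsto_const_nhds.congr' ?_
    filter_upwards [eventually_ne_atTop 0] with x hx
    have hx' : (x : ℝ) ≠ 0 := by exact_mod_cast hx
    field_simp
  have h2 : IsEquivalent atTop (fun x : ℕ => u x / (x : ℝ)) (fun x : ℕ => C * (x : ℝ) / (x : ℝ)) :=
    h.div IsEquivalent.refl
  exact h2.symm.tendsto_nhds h1

/-! ## `S → C`: the summit implies the Abel-mean form and the slow-decrease crux -/

/-- Bateman–Horn for `f` (count form) gives the Cesàro mean `x⁻¹ Σ_{n≤x} ∏ᵢ Λ(fᵢ(n)) → C(f)`. -/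
theorem cesaro_of_batemanHorn (hBH : _root_.BatemanHorn) {k : ℕ} {f : Fin k → Polynomial ℤ}
    (hf : IsBatemanHornSystem f) :
    Tendsto (fun x : ℕ => (∑ n ∈ Icc 1 x,
      ∏ i, ArithmeticFunction.vonMangoldt (((f i).eval (n : ℤ)).toNat)) / (x : ℝ))
      atTop (𝓝 (batemanHornConst f)) := by
  obtain ⟨hHas, hCpos⟩ := IsBatemanHornSystem.hasBatemanHornConst_holds hf
  exact tendsto_div_of_isEquivalent _ _
    (lambda_isEquivalent_of_batemanHornAsymptotic hf hCpos hHas (hBH k f hf))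

/-- **`BatemanHorn → AbelBatemanHorn`**: the summit conjunct implies the Abel-mean (logarithmic
density) form, for every system, with the Bateman–Horn constant. -/
theorem abelBatemanHorn_of_batemanHorn (hBH : _root_.BatemanHorn) : AbelBatemanHorn := by
  intro k f hf
  obtain ⟨hHas, hCpos⟩ := IsBatemanHornSystem.hasBatemanHornConst_holds hf
  obtain ⟨hsum, habel⟩ := abel_of_cesaro (lambdaProd_nonneg f) (cesaro_of_batemanHorn hBH hf)
  exact ⟨batemanHornConst f, hCpos, hHas, hsum, habel⟩

/-- **`BatemanHorn → SlowDecrease`** (crux r3, stmt-Parity-19023, is a consequence of the summit):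
a convergent Cesàro mean is slowly decreasing on every scale (take `δ = 1`). -/
theorem slowDecrease_of_batemanHorn (hBH : _root_.BatemanHorn) : SlowDecrease := by
  intro k f hf ε hε
  have hlim := cesaro_of_batemanHorn hBH hf
  rw [Metric.tendsto_atTop] at hlim
  obtain ⟨N₀, hN₀⟩ := hlim (ε / 2) (by positivity)
  refine ⟨1, one_pos, N₀, fun N N' hN hNN' _ => ?_⟩
  have h1 := hN₀ N hN
  have h2 := hN₀ N' (hN.trans hNN')
  rw [Real.dist_eq, abs_lt] at h1 h2
  linarith [h1.1, h1.2, h2.1, h2.2]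

/-- `FrameToBH` (crux r5) is trivially a consequence of the summit. -/
theorem frameToBH_of_batemanHorn (hBH : _root_.BatemanHorn) : FrameToBH :=
  fun k f hf _ _ _ => hBH k f hf

/-! ## The costume: modulo the route's own parity-free items, `LogMobiusTail` IS Abel-mean Bateman–Horn -/

/-- **`LogMobiusTail ↔ AbelBatemanHorn`** modulo the route's parity-free crux `RootHurwitzLaw`
(r4) and its theorem-grade supports `PolarPart` (exact Hurwitz-frame identity) and
`SingularSeriesAbel` (singular series).  `→` is the route's own Abel step; `←` identifies the
constants by uniqueness of the limit of the ordered Euler product and solves the frame identity for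
the tail. -/
theorem logMobiusTail_iff_abelBatemanHorn (hR : RootHurwitzLaw) (hP : PolarPart)
    (hS : SingularSeriesAbel) : LogMobiusTail ↔ AbelBatemanHorn := by
  constructor
  · intro hT k f hf
    obtain ⟨C, hC, hBH, hSsum, hSlim⟩ := hS k f hf
    obtain ⟨hPσ, hPlim⟩ := hP k f hf
    obtain ⟨hT1, hT2⟩ := hT k f hf
    obtain ⟨hR1, hR2⟩ := hR k f hf
    refine ⟨C, hC, hBH, fun σ hσ => (hPσ σ hσ).1, ?_⟩
    exact abel_limit_of_pieces k _ _ _ _ _ C (fun σ hσ => (hPσ σ hσ).2.2.2.2.2) hT2 hPlim hR2 hSlim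
  · intro hA k f hf
    obtain ⟨C', hC', hBH', hsum', hlim'⟩ := hA k f hf
    obtain ⟨C, hC, hBH, hSsum, hSlim⟩ := hS k f hf
    obtain ⟨hPσ, hPlim⟩ := hP k f hf
    obtain ⟨hR1, hR2⟩ := hR k f hf
    have hCC : C' = C := tendsto_nhds_unique hBH' hBH
    subst hCC
    refine ⟨fun σ hσ => (hPσ σ hσ).2.1, ?_⟩
    exact tail_limit_of_pieces k _ _ _ _ _ C' (fun σ hσ => (hPσ σ hσ).2.2.2.2.2) hlim' hPlim hR2 hSlim

/-- **`S → C` modulo the route's parity-free items**: Bateman–Horn implies the deciding crux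
`LogMobiusTail`, given `RootHurwitzLaw`, `PolarPart`, `SingularSeriesAbel`. -/
theorem logMobiusTail_of_batemanHorn (hR : RootHurwitzLaw) (hP : PolarPart) (hS : SingularSeriesAbel)
    (hBH : _root_.BatemanHorn) : LogMobiusTail :=
  (logMobiusTail_iff_abelBatemanHorn hR hP hS).mpr (abelBatemanHorn_of_batemanHorn hBH)

/-! ## The conjunct split: `BatemanHorn ↔ (Abel-mean BH) ∧ SlowDecrease` modulo theorem-grade supports -/

/-- **Tauberian half** (the route's frame chain without the Möbius tail): Abel mean + slow decrease
⇒ Bateman–Horn, given the supports `LambdaUpperBound` (Brun), `KaramataLog` (Hardy–Littlewood /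
Karamata), `SchmidtScales` (Schmidt / Móricz) and the tree theorem `lambdaToCount_proof`. -/
theorem batemanHorn_of_abel_and_slow (hB : LambdaUpperBound) (hK : KaramataLog) (hSch : SchmidtScales)
    (hA : AbelBatemanHorn) (hSlow : SlowDecrease) : _root_.BatemanHorn := by
  intro k f hf
  obtain ⟨C, hC, hHas, hsum, habel⟩ := hA k f hf
  have hlog : Tendsto (fun x : ℕ => (∑ n ∈ Icc 1 x,
      (∏ i, ArithmeticFunction.vonMangoldt (((f i).eval (n : ℤ)).toNat)) / n) / Real.log x)
      atTop (𝓝 C) :=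
    hK (fun n => ∏ i, ArithmeticFunction.vonMangoldt (((f i).eval (n : ℤ)).toNat))
      (fun n => lambdaProd_nonneg f n) C hsum habel
  have hces : Tendsto (fun x : ℕ => (∑ n ∈ Icc 1 x,
      ∏ i, ArithmeticFunction.vonMangoldt (((f i).eval (n : ℤ)).toNat)) / x) atTop (𝓝 C) :=
    hSch (fun n => ∏ i, ArithmeticFunction.vonMangoldt (((f i).eval (n : ℤ)).toNat))
      (fun n => lambdaProd_nonneg f n) (hB k f hf) C hlog (hSlow k f hf)
  exact Summit.Parity.BatemanHorn.LambdaToCount.lambdaToCount_proof k f hf C hC hHas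
    (isEquivalent_of_tendsto_div _ C hC.ne' hces)

/-- **Conjunct split certificate.**  Modulo the theorem-grade supports `LambdaUpperBound`,
`KaramataLog`, `SchmidtScales`, the summit conjunct `BatemanHorn` is EXACTLY the conjunction of the
Abel-mean form and the slow-decrease crux. -/
theorem batemanHorn_iff_abel_and_slow (hB : LambdaUpperBound) (hK : KaramataLog)
    (hSch : SchmidtScales) : _root_.BatemanHorn ↔ (AbelBatemanHorn ∧ SlowDecrease) :=
  ⟨fun h => ⟨abelBatemanHorn_of_batemanHorn h, slowDecrease_of_batemanHorn h⟩,
    fun h => batemanHorn_of_abel_and_slow hB hK hSch h.1 h.2⟩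

/-- **Conjunct split certificate, tail form.**  Modulo the route's parity-free crux `RootHurwitzLaw`
and its five theorem-grade supports, `BatemanHorn ↔ LogMobiusTail ∧ SlowDecrease`: the route's two
parity-sensitive cruxes are JOINTLY equivalent to the summit conjunct (tribunal T1′: an unassigned
conjunct split), and the deciding crux `LogMobiusTail` is the logarithmic-density conjunct. -/
theorem batemanHorn_iff_tail_and_slow (hR : RootHurwitzLaw) (hP : PolarPart) (hS : SingularSeriesAbel)
    (hB : LambdaUpperBound) (hK : KaramataLog) (hSch : SchmidtScales) :
    _root_.BatemanHorn ↔ (LogMobiusTail ∧ SlowDecrease) := by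
  rw [logMobiusTail_iff_abelBatemanHorn hR hP hS]
  exact batemanHorn_iff_abel_and_slow hB hK hSch

end Summit.Parity.BatemanHorn.Cruxes.LogMobiusTail.StrategyCensus
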